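import Mathlib

/-!
# THE MIRROR INEQUALITY OF THE PARALLEL-CLASSES MODEL (night-3 g29)

`proofs/NIGHT3-G29-PARALLEL.md` §1.  On a matroid whose ground set is a union of `k` parallel classes (a free point is a
class of one element) every rank is a number of classes met, and PER-LAYER DOMINANCE (the hypothesis of the landed bridge
`PLDBridge.rls_disjointSum_freeOn_of_pld`) splits by the number `s` of classes met properly into one inequality between two
window sums of `T(φ) = C(n, φ)·C(n + s − φ, δ)` (`n` = the number of classes not met properly): the right-hand window is the
mirror image `φ ↦ n − δ − φ` of the left-hand one, and `T(φ) ≤ T(n − δ − φ)` exactly when `2φ + δ ≤ n` (`mirror_le`; at `s = 0`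
equality).  Written out, the mirror inequality is `C(A + s + δ, δ)·C(φ + δ, δ) ≤ C(A + δ, δ)·C(φ + s + δ, δ)` for `φ ≤ A`
(`choose_mul_choose_le`), a product of `δ` termwise inequalities `(A + s + i)(φ + i) ≤ (φ + s + i)(A + i)`
(`ascFactorial_mul_le`).  `sum_le_sum_mirror` is the abstract window argument and `per_s` the inequality the matroid
module needs, in the exact shape produced by the fibre decomposition.
No `def`, no `instance`, no notation.  Axioms: standard.
-/

namespace PercRepro

open Finset

namespace ParallelPLD

/-- The product of the termwise inequalities `(A + s + 1 + i)(φ + 1 + i) ≤ (φ + s + 1 + i)(A + 1 + i)`, `i < δ`. -/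
theorem ascFactorial_mul_le (A φ s : ℕ) (h : φ ≤ A) (δ : ℕ) :
    (A + s + 1).ascFactorial δ * (φ + 1).ascFactorial δ ≤
      (φ + s + 1).ascFactorial δ * (A + 1).ascFactorial δ := by
  induction δ with
  | zero => simp
  | succ d ih =>
    rw [Nat.ascFactorial_succ, Nat.ascFactorial_succ, Nat.ascFactorial_succ, Nat.ascFactorial_succ]
    have h1 : (A + s + 1 + d) * (φ + 1 + d) ≤ (φ + s + 1 + d) * (A + 1 + d) := by
      have := Nat.mul_le_mul_left s h
      nlinarith
    calc (A + s + 1 + d) * (A + s + 1).ascFactorial d * ((φ + 1 + d) * (φ + 1).ascFactorial d)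
        = ((A + s + 1 + d) * (φ + 1 + d)) * ((A + s + 1).ascFactorial d * (φ + 1).ascFactorial d) := by
          ring
      _ ≤ ((φ + s + 1 + d) * (A + 1 + d)) * ((φ + s + 1).ascFactorial d * (A + 1).ascFactorial d) :=
          Nat.mul_le_mul h1 ih
      _ = (φ + s + 1 + d) * (φ + s + 1).ascFactorial d * ((A + 1 + d) * (A + 1).ascFactorial d) := by
          ring

/-- The mirror inequality in binomial form: `C(A + s + δ, δ)·C(φ + δ, δ) ≤ C(A + δ, δ)·C(φ + s + δ, δ)` for `φ ≤ A`. -/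
theorem choose_mul_choose_le (A φ s δ : ℕ) (h : φ ≤ A) :
    (A + s + δ).choose δ * (φ + δ).choose δ ≤ (A + δ).choose δ * (φ + s + δ).choose δ := by
  have key := ascFactorial_mul_le A φ s h δ
  have e1 : δ.factorial * (A + s + δ).choose δ = (A + s + 1).ascFactorial δ := by
    rw [← Nat.descFactorial_eq_factorial_mul_choose, Nat.add_descFactorial_eq_ascFactorial]
  have e2 : δ.factorial * (φ + δ).choose δ = (φ + 1).ascFactorial δ := by
    rw [← Nat.descFactorial_eq_factorial_mul_choose, Nat.add_descFactorial_eq_ascFactorial]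
  have e3 : δ.factorial * (A + δ).choose δ = (A + 1).ascFactorial δ := by
    rw [← Nat.descFactorial_eq_factorial_mul_choose, Nat.add_descFactorial_eq_ascFactorial]
  have e4 : δ.factorial * (φ + s + δ).choose δ = (φ + s + 1).ascFactorial δ := by
    rw [← Nat.descFactorial_eq_factorial_mul_choose, Nat.add_descFactorial_eq_ascFactorial]
  have hpos : 0 < δ.factorial * δ.factorial := Nat.mul_pos (Nat.factorial_pos δ) (Nat.factorial_pos δ)
  refine Nat.le_of_mul_le_mul_right ?_ hpos
  calc (A + s + δ).choose δ * (φ + δ).choose δ * (δ.factorial * δ.factorial)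
      = (δ.factorial * (A + s + δ).choose δ) * (δ.factorial * (φ + δ).choose δ) := by ring
    _ = (A + s + 1).ascFactorial δ * (φ + 1).ascFactorial δ := by rw [e1, e2]
    _ ≤ (φ + s + 1).ascFactorial δ * (A + 1).ascFactorial δ := key
    _ = (δ.factorial * (A + δ).choose δ) * (δ.factorial * (φ + s + δ).choose δ) := by
        rw [e3, e4, mul_comm]
    _ = (A + δ).choose δ * (φ + s + δ).choose δ * (δ.factorial * δ.factorial) := by ring

/-- The pointwise mirror inequality `T(φ) ≤ T(n − δ − φ)` for `T(φ) = C(n, φ)·C(n + s − φ, δ)`, written with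
`n = φ + δ + A`, `φ ≤ A` (so `n − δ − φ = A` and `C(n, A) = C(n, φ + δ)`). -/
theorem mirror_le (A φ s δ : ℕ) (h : φ ≤ A) :
    (φ + δ + A).choose φ * (A + s + δ).choose δ ≤
      (φ + δ + A).choose (φ + δ) * (φ + s + δ).choose δ := by
  have hm : (φ + δ + A).choose (φ + δ) * (φ + δ).choose φ =
      (φ + δ + A).choose φ * (A + δ).choose δ := by
    have := Nat.choose_mul (n := φ + δ + A) (k := φ + δ) (s := φ) (Nat.le_add_right φ δ)
    have e1 : φ + δ + A - φ = A + δ := by omega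
    have e2 : φ + δ - φ = δ := by omega
    rw [this, e1, e2]
  have hpos : 0 < (φ + δ).choose φ := Nat.choose_pos (Nat.le_add_right φ δ)
  refine Nat.le_of_mul_le_mul_right ?_ hpos
  calc (φ + δ + A).choose φ * (A + s + δ).choose δ * (φ + δ).choose φ
      = (φ + δ + A).choose φ * ((A + s + δ).choose δ * (φ + δ).choose δ) := by
        rw [Nat.choose_symm_add]; ring
    _ ≤ (φ + δ + A).choose φ * ((A + δ).choose δ * (φ + s + δ).choose δ) :=
        Nat.mul_le_mul_left _ (choose_mul_choose_le A φ s δ h)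
    _ = ((φ + δ + A).choose (φ + δ) * (φ + δ).choose φ) * (φ + s + δ).choose δ := by rw [hm]; ring
    _ = (φ + δ + A).choose (φ + δ) * (φ + s + δ).choose δ * (φ + δ).choose φ := by ring

/-- `T(φ) ≤ T(n − δ − φ)` whenever `2φ ≤ n − δ`, for `T(φ) = C(n, φ)·C(n + s − φ, δ)`. -/
theorem T_le_T_mirror (n s δ φ : ℕ) (h : 2 * φ ≤ n - δ) :
    n.choose φ * (n + s - φ).choose δ ≤ n.choose (n - δ - φ) * (n + s - (n - δ - φ)).choose δ := by
  rcases le_or_gt δ n with hδ | hδ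
  · obtain ⟨A, hA⟩ : ∃ A, n = φ + δ + A := ⟨n - δ - φ, by omega⟩
    have hφA : φ ≤ A := by omega
    have e1 : n - δ - φ = A := by omega
    have e2 : n + s - φ = A + s + δ := by omega
    have e3 : n + s - A = φ + s + δ := by omega
    rw [e1, e2, e3, hA]
    have e4 : (φ + δ + A).choose A = (φ + δ + A).choose (φ + δ) := (Nat.choose_symm_add).symm
    rw [e4]
    exact mirror_le A φ s δ hφA
  · have h0 : φ = 0 := by omega
    subst h0
    have e1 : n - δ - 0 = 0 := by omega
    rw [e1]

/-- The abstract window argument: if `T(φ) ≤ T(m − φ)` on the left half and every element of `W` whose mirror is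
outside `W` lies in the left half, then `Σ_W T ≤ Σ_W T ∘ (m − ·)`. -/
theorem sum_le_sum_mirror (T : ℕ → ℕ) (m : ℕ) (W : Finset ℕ) (hW : ∀ φ ∈ W, φ ≤ m)
    (hT : ∀ φ, 2 * φ ≤ m → T φ ≤ T (m - φ)) (hpair : ∀ φ ∈ W, m - φ ∉ W → 2 * φ ≤ m) :
    ∑ φ ∈ W, T φ ≤ ∑ φ ∈ W, T (m - φ) := by
  rw [← Finset.sum_filter_add_sum_filter_not W (fun φ => m - φ ∈ W) T,
    ← Finset.sum_filter_add_sum_filter_not W (fun φ => m - φ ∈ W) (fun φ => T (m - φ))]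
  refine Nat.add_le_add (le_of_eq ?_) (Finset.sum_le_sum fun φ hφ => ?_)
  · refine Finset.sum_nbij' (fun φ => m - φ) (fun φ => m - φ) ?_ ?_ ?_ ?_ ?_
    · intro φ hφ
      rw [Finset.mem_filter] at hφ ⊢
      refine ⟨hφ.2, ?_⟩
      have := hW φ hφ.1
      rw [show m - (m - φ) = φ by omega]
      exact hφ.1
    · intro φ hφ
      rw [Finset.mem_filter] at hφ ⊢
      refine ⟨hφ.2, ?_⟩
      have := hW φ hφ.1
      rw [show m - (m - φ) = φ by omega]
      exact hφ.1
    · intro φ hφ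
      rw [Finset.mem_filter] at hφ
      have := hW φ hφ.1
      show m - (m - φ) = φ
      omega
    · intro φ hφ
      rw [Finset.mem_filter] at hφ
      have := hW φ hφ.1
      show m - (m - φ) = φ
      omega
    · intro φ hφ
      rw [Finset.mem_filter] at hφ
      have := hW φ hφ.1
      show T φ = T (m - (m - φ))
      rw [show m - (m - φ) = φ by omega]
  · rw [Finset.mem_filter] at hφ
    exact hT φ (hpair φ hφ.1 hφ.2)

/-- The per-`s` inequality of the parallel-classes model, in the shape produced by the fibre decomposition:
`n` classes are not met properly, `s` are, `T(φ) = C(n, φ)·C(n + s − φ, δ)` counts the full-class sets `Φ` of size `φ`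
together with the `δ`-sets of classes not full; the left window is `lo ≤ s + φ ≤ hi` (with the threshold `Θ ≤ n + 2s`),
the right window `lo + δ ≤ n + s − φ ≤ hi + δ`. -/
theorem per_s (n s δ lo hi Θ : ℕ) (hlo : lo = 0 ∨ lo + hi + δ ≤ Θ) :
    ∑ φ ∈ range (n + 1), n.choose φ *
        (if lo ≤ s + φ ∧ s + φ ≤ hi ∧ Θ ≤ (n + s - φ) + (s + φ) then (n + s - φ).choose δ else 0) ≤
      ∑ φ ∈ range (n + 1), n.choose φ *
        (if lo + δ ≤ n + s - φ ∧ n + s - φ ≤ hi + δ then (n + s - φ).choose δ else 0) := by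
  -- the threshold does not depend on `φ`
  have hthr : ∀ φ ∈ range (n + 1), (n + s - φ) + (s + φ) = n + 2 * s := by
    intro φ hφ
    rw [Finset.mem_range] at hφ
    omega
  rcases lt_or_ge (n + 2 * s) Θ with hΘ | hΘ
  · -- the left side vanishes
    refine le_trans (le_of_eq (Finset.sum_eq_zero fun φ hφ => ?_)) (Nat.zero_le _)
    rw [hthr φ hφ, if_neg (by omega), mul_zero]
  -- from now on `Θ ≤ n + 2s`, so `lo = 0 ∨ lo + hi + δ ≤ n + 2s`
  have hlo' : lo = 0 ∨ lo + hi + δ ≤ n + 2 * s := by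
    rcases hlo with h | h
    · exact Or.inl h
    · exact Or.inr (le_trans h hΘ)
  have hL : ∀ φ ∈ range (n + 1),
      n.choose φ * (if lo ≤ s + φ ∧ s + φ ≤ hi ∧ Θ ≤ (n + s - φ) + (s + φ) then (n + s - φ).choose δ else 0) =
        if lo ≤ s + φ ∧ s + φ ≤ hi then n.choose φ * (n + s - φ).choose δ else 0 := by
    intro φ hφ
    rw [hthr φ hφ]
    by_cases h : lo ≤ s + φ ∧ s + φ ≤ hi
    · rw [if_pos ⟨h.1, h.2, hΘ⟩, if_pos h]
    · rw [if_neg (fun h' => h ⟨h'.1, h'.2.1⟩), if_neg h, mul_zero]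
  have hR : ∀ φ ∈ range (n + 1),
      n.choose φ * (if lo + δ ≤ n + s - φ ∧ n + s - φ ≤ hi + δ then (n + s - φ).choose δ else 0) =
        if lo + δ ≤ n + s - φ ∧ n + s - φ ≤ hi + δ then n.choose φ * (n + s - φ).choose δ else 0 := by
    intro φ _
    by_cases h : lo + δ ≤ n + s - φ ∧ n + s - φ ≤ hi + δ
    · rw [if_pos h, if_pos h]
    · rw [if_neg h, if_neg h, mul_zero]
  rw [Finset.sum_congr rfl hL, Finset.sum_congr rfl hR]
  rcases lt_or_ge (n + s) (hi + δ) with hB | hA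
  · -- CASE B: `hi + δ > n + s`: every nonzero left term is a right term
    refine Finset.sum_le_sum fun φ hφ => ?_
    rw [Finset.mem_range] at hφ
    by_cases hP : lo ≤ s + φ ∧ s + φ ≤ hi
    · rw [if_pos hP]
      by_cases hQ : lo + δ ≤ n + s - φ ∧ n + s - φ ≤ hi + δ
      · rw [if_pos hQ]
      · rw [if_neg hQ]
        -- the left term is zero: `n + s − φ < δ` (only possible when `lo = 0`)
        have hlt : n + s - φ < lo + δ := by omega
        rcases hlo' with h0 | h0
        · subst h0
          have hz : (n + s - φ).choose δ = 0 := Nat.choose_eq_zero_of_lt (by omega)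
          rw [hz, mul_zero]
        · exfalso
          omega
    · rw [if_neg hP]
      exact Nat.zero_le _
  · -- CASE A: `hi + δ ≤ n + s`: the mirror `φ ↦ n − δ − φ` carries the left window into the right one
    rw [← Finset.sum_filter, ← Finset.sum_filter]
    have hWm : ∀ φ ∈ (range (n + 1)).filter (fun φ => lo ≤ s + φ ∧ s + φ ≤ hi), φ ≤ n - δ := by
      intro φ hφ
      rw [Finset.mem_filter, Finset.mem_range] at hφ
      omega
    have hsub : ((range (n + 1)).filter (fun φ => lo ≤ s + φ ∧ s + φ ≤ hi)).image (fun φ => n - δ - φ) ⊆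
        (range (n + 1)).filter (fun φ => lo + δ ≤ n + s - φ ∧ n + s - φ ≤ hi + δ) := by
      intro ψ hψ
      rw [Finset.mem_image] at hψ
      obtain ⟨φ, hφ, rfl⟩ := hψ
      have := hWm φ hφ
      rw [Finset.mem_filter, Finset.mem_range] at hφ ⊢
      omega
    have hinj : Set.InjOn (fun φ => n - δ - φ)
        ↑((range (n + 1)).filter (fun φ => lo ≤ s + φ ∧ s + φ ≤ hi)) := by
      intro φ₁ hφ₁ φ₂ hφ₂ h
      have h1 := hWm φ₁ hφ₁
      have h2 := hWm φ₂ hφ₂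
      simp only at h
      omega
    calc ∑ φ ∈ (range (n + 1)).filter (fun φ => lo ≤ s + φ ∧ s + φ ≤ hi),
            n.choose φ * (n + s - φ).choose δ
        ≤ ∑ φ ∈ (range (n + 1)).filter (fun φ => lo ≤ s + φ ∧ s + φ ≤ hi),
            n.choose (n - δ - φ) * (n + s - (n - δ - φ)).choose δ := by
          refine sum_le_sum_mirror (fun φ => n.choose φ * (n + s - φ).choose δ) (n - δ) _ hWm
            (fun φ h => T_le_T_mirror n s δ φ h) ?_
          intro φ hφ hnot
          by_contra hcon
          apply hnot
          have := hWm φ hφ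
          rw [Finset.mem_filter, Finset.mem_range] at hφ ⊢
          rcases hlo' with h0 | h0 <;> omega
      _ = ∑ ψ ∈ ((range (n + 1)).filter (fun φ => lo ≤ s + φ ∧ s + φ ≤ hi)).image (fun φ => n - δ - φ),
            n.choose ψ * (n + s - ψ).choose δ :=
          (Finset.sum_image (f := fun ψ => n.choose ψ * (n + s - ψ).choose δ) hinj).symm
      _ ≤ ∑ ψ ∈ (range (n + 1)).filter (fun φ => lo + δ ≤ n + s - φ ∧ n + s - φ ≤ hi + δ),
            n.choose ψ * (n + s - ψ).choose δ :=
          Finset.sum_le_sum_of_subset_of_nonneg hsub (fun _ _ _ => Nat.zero_le _)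

end ParallelPLD

end PercRepro
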